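/-
Copyright (c) 2026 the pub-hodgecm-mathlib formalisation cell (harness21).  Prover seat hodgecm-mathlib-LH4-p13 (g6), req620 Track A «(D-RAM) FOUR-FRAME» squad, unit U2H:
the (ρ2b′-X) child `stub_U2H_fixedPointCensus_typeTwo_unit0` (U2H :418) — seam **S6b-RK «REALIZABILITY, TYPE RamK»** of the payer LH4-p14 (g4)'s HEAD-OF-ORGANS MAP v2
(dealer LH4-plan (g12) WORD #28 «S9-R + tok → p13»; hand re-taken by the heir 2026-09-04T05:48Z), the RK twin of ★ p857510 `F0P3cDyRamTokenRealizabilityUnr`.  2026-09-04.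
-/
import Summits.HodgeConjecture.HodgeConjecture.Theorems.F0P3cDyRamTokenRealizabilityUnr   -- ★ p857510 (this lineage, g5): `coords_eq_zero`, `v_coords_eq_max`; brings ★ `WildQuadraticDatumNormOneDepth` (`v_varpi_pow`, `exists_fixed_coords_of_map_ne`)
import HarnessLib

/-!
# Crux `H413`, line LH4 «(D-RAM) FOUR-FRAME» — unit U2H, (ρ2b′-X): seam S6b-RK — REALIZABILITY OF THE TYPE-RamK TOKENS
# `m ≡ d (2)`, `m ≤ jλ`, `jλ ≡ d (2)` for every deep Θ-unitary `ξ = λ∕u`, and THE `ε = −1` WINDOW: for `ℓ = jλ − m ≥ 2d − 1` the HYPERBOLIC side is alive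

Cell `hodgecm-mathlib` (D-0151), FLOOR 0, crux item H413 = `stmt-HodgeConjecture-24833`, route of record `HCCMUnconditional`; squad F0∕P3c∕LH4; registered stub served:
`F0P3cDyRamFourFrameU2H.stub_U2H_fixedPointCensus_typeTwo_unit0` ((ρ2b′-X), U2H :418) through LH4-p14's ★ spine and its HEAD-OF-ORGANS; this file DISCHARGES the token
hypotheses `hpar : m % 2 = d % 2`, `hm : m ≤ jl`, `hjl : jl % 2 = d % 2` of ★ p857635 `F0P3cDyRamToricCensusSumRamK.toricCensusSum_ramK` (LH4-p04 (g4)) as FACTS about the descent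
data of a deep type-(2) `γ_H` of TYPE RamK, in the ONE-FIELD letters of the T5b sheet, and proves the mechanism behind its window `hε : ε = 1 ∨ (ε = −1 ∧ jl + 2 ≤ m + 2d)`:
when `ℓ := jl − m ≥ 2d − 1`, every diagonal sign cell that is alive on SOME side is alive on the HYPERBOLIC side (§3, in the T5b (D3) `halive` letters).  THEOREMS ONLY
(no `def`, no instance, no notation, no `sorry`); lane `--supports stmt-HodgeConjecture-24833` (count-neutral).

THE FRAME (type RamK = «M∕E unramified, THIRD FIELD `K♮ = Fix Θ` UNRAMIFIED over `F`, descent field `K = Fix(Θρ)` ramified»).  `M` (the Lean `K`) carries commuting isometric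
involutions `ρ` (fixing `E`) and `Θ` (`Θ|_E = σ`); TYPE RamK supplies an integral **`Θ`-FIXED** `α` with `|α − ρα| = 1` (an unramified generator of `K♮∕F`, hence of `M∕E`:
`𝒪_M = 𝒪_E ⊕ 𝒪_E·α`) — the type-U file had `Θα = ρα` instead.  `T := α + ρα` (a unit: `|2| < 1`) and `N := α·ρα` lie in `F`.

THE MATHEMATICS (§1).  For a Θ-unitary `ξ` (`ξ·Θξ = 1`) write `ξ − 1 = e₀ + e₁α` (`ρe_i = e_i`); then `|e₁| = |ξ − ρξ| = exp(−jl)`, `|ξ − 1| = max(|e₀|, |e₁|) = exp(−m)`, so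
`m ≤ jl`.  Comparing coordinates in `ξ·Θξ = 1` (`α² = Tα − N`) gives, with `ε₀ := 1 + e₀ ∈ 𝒪_Eˣ` and `q := e₁∕ε₀` (`|q| = exp(−jl)`):
**(TRACE) `q + Θq = −T·qΘq`** and **(NORM) `N_{E∕F}(ε₀)·(1 − N·qΘq) = 1`**.  (TRACE) applied to the `ρ`-fixed `e := q·(ϖE·ΘϖE)` (`|e| = |ϖE|^{jl+2}`) gives
`|N_{E∕F}(1 + e) − 1| = |qΘq|·|ϖEΘϖE|·|ϖEΘϖE − T| = |ϖE|^{2jl+2}`, while the E-side norm-depth law (★ `WildQuadraticDatumNormOneDepth`, the SAME `hNeq` input as type U) would force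
`= |ϖE|^{jl+2+d−1}` if `jl ≢ d (2)` — i.e. `jl = d − 1 < d ≤ m ≤ jl`: so **`jl ≡ d (2)`**.  (NORM) gives `|N_{E∕F}(ε₀) − 1| ≤ |qΘq| = exp(−2jl)`; if `m ≢ d (2)` then `m < jl`,
`|e₀| = exp(−m)`, and `hNeq` forces `exp(−(m+d−1)) ≤ exp(−2jl)`, i.e. `2jl ≤ m + d − 1 < 2jl`: so **`m ≡ d (2)`**.  (`hFev` of the type-U head is NOT needed.)
THE WINDOW (§3).  On a diagonal sign cell of ρ-depth `c ≥ 1` the (D3) datum is a unit `z` with `|z − ρz| ≤ exp(−ℓ)` (for the hyperbolic `z₊ = μ·h·(α₀ − ρα₀)∕ϖE^n`, `ρh = −h`: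
`|z₊ − ρz₊| = exp(−ℓ)`, §3 bridge).  If `z = k·e·w` with `k ∈ 𝒪_{K♮}ˣ`, `e ∈ 𝒪_Eˣ`, `|w − 1| ≤ exp(−c)` («some side alive») then `k = f₀(1 + gα)` with `f₀ ∈ 𝒪_Fˣ`, `g ∈ F`,
`|g| ≤ max(exp(−ℓ), exp(−c))`; `f₀` is a norm `x₀Θx₀` (★ `QuadraticDatumNormsOfDoublyFixedUnits`: `𝒪_Fˣ ⊆ N_{M∕K♮}(𝒪_Mˣ)`), and either `|g| ≤ exp(−c)` (absorb `1 + gα` into `w`) or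
`|g| ≤ exp(−ℓ) ≤ exp(−(2d−1))`, whence — `g ∈ F` has EVEN valuation — `|g| ≤ exp(−2d) = |ϖE|^{2d}` and `1 + gα ∈ U_{K♮}^{(d)}` is a norm `x₁Θx₁` (★ `WildQuadraticDatumNormSurjective`,
Serre V §3 Cor. 3 on the datum `(M, Θ, ϖE, d, t)`): in both cases `z = xΘx·e·w′`, the HYPERBOLIC side is alive.  So for `ℓ ≥ 2d − 1` the far cells (`c ≥ 2d − 1`) never live on
the anisotropic side alone: `ε = −1 ⇒ ℓ ≤ 2d − 2`, the window of ★ `toricCensusSum_ramK` (LH4-p04 (g4): «for ℓ ≥ 2d the K♮-part of μ lies in 𝒪_Fˣ·U_{K♮}^{(ℓ∕2)} ⊆ N»).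
INTERFACE.  `hNeq` = ★ p857485 `v_norm_sub_one_eq_of_isRamifiedQuadraticDatum` along `jE` (as in type U); `hNF` = ★ `exists_mul_map_eq_of_fixed_fixed_of_isRamifiedQuadraticDatum`
(∕ `…_of_thirdField`, p857442); `hNd` = ★ `exists_mul_map_eq_of_isRamifiedQuadraticDatum` (`[IsAdicComplete 𝓂[K] 𝒪[K]]`); `hΘev` = the datum clause «Θ-fixed elements have
even valuation» of `IsRamifiedQuadraticDatum Θ ϖE d t` (★ T5b frame `IsRamKFrame`).  Evidence: F0P3-p01 (g32) T5b memo §7 (RamK cells (2,2), (2,3): alive side vs ε, 140∕152 +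
all; the 12 exceptions at `m ≤ d`, outside the tube), LH4-r01 (g5) K-ram cells T4b∕D4r∕D5r (LH4-p13 (g5) row check 05:32Z: `ε = −1` only at `ℓ ≤ 2d − 2`).
HONEST LABEL.  Count-neutral helper; (ρ2b′-X) OPEN; `HC_CM` is proved only modulo the 7 printed citations (2 remaining named inputs: hLiu418 = `stmt-HodgeConjecture-24832`, h413 =
`stmt-HodgeConjecture-24833`) until rung 0 closes.

## References
* [Serre1979] J.-P. Serre, *Local Fields*, GTM 67 (1979), Ch. V §2 Prop. 3, §3 Prop. 5 and Cor. 3; Ch. III §6 Prop. 12.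
* [Rogawski1990] J. D. Rogawski, *Automorphic Representations of Unitary Groups in Three Variables*, Ann. of Math. Stud. 123 (1990), §4.9 Prop. 4.9.1 (b) p. 55, Lemma 4.9.3 p. 56.
* [Kottwitz1986BaseChangeUnits] R. E. Kottwitz, *Base change for unit elements of Hecke algebras*, Compositio Math. 60 (1986), §1 pp. 240–241.
* [Flicker1998UnitaryFL] Y. Z. Flicker, *Elementary proof of the fundamental lemma for a unitary group*, Canad. J. Math. 50 (1998), Prop. 7 p. 84.
-/

set_option autoImplicit false

open WithZero

namespace Summit.HodgeConjecture.HodgeConjecture.Cruxes.H413.F0P3cDyRamTokenRealizabilityRamK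

open Summit.HodgeConjecture.HodgeConjecture.Cruxes.H413.F0P3cDyRamTokenRealizabilityUnr (coords_eq_zero v_coords_eq_max)

variable {K : Type*} [Field K] [Valued K ℤᵐ⁰]

/-! ## §1 REALIZABILITY for a Θ-unitary element, type RamK -/

/-- **REALIZABILITY OF THE TYPE-RamK TOKENS (abstract form).**  `ρ, Θ` commuting involutions of the valued field `K` (= the biquadratic `M`), `ρ` and `Θ` isometric, `ϖE` a
`ρ`-fixed uniformiser, `|2| < 1` (wild); `α` integral, `Θ`-FIXED, with `|α − ρα| = 1` (TYPE RamK: the third field `Fix Θ` is unramified over `F`); the E-side norm-depth law for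
`ρ`-fixed elements off the parity of `d` (`hNeq`: ★ `WildQuadraticDatumNormOneDepth` along `jE`), `2 ≤ d`.  Then every Θ-unitary `ξ` with `|ξ − 1| = exp(−m)`, `|ξ − ρξ| = exp(−jl)`,
`d ≤ m` satisfies `m ≡ d (2)`, `m ≤ jl`, `jl ≡ d (2)` — the hypotheses `hpar`, `hm`, `hjl` of ★ `toricCensusSum_ramK`.
[cite: Serre1979, Ch. V §3 Prop. 5; Ch. III §6 Prop. 12] [cite: Rogawski1990, §4.9 Lemma 4.9.3 p. 56] -/
theorem realizable_of_thetaUnitary_ramK {ρ Θ : K →+* K} (hρρ : ∀ x, ρ (ρ x) = x) (hΘΘ : ∀ x, Θ (Θ x) = x) (hρΘ : ∀ x, ρ (Θ x) = Θ (ρ x))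
    (hρv : ∀ x, Valued.v (ρ x) = Valued.v x) (hΘv : ∀ x, Valued.v (Θ x) = Valued.v x)
    {ϖE : K} (hϖE : Valued.v ϖE = exp (-1 : ℤ)) (hρϖ : ρ ϖE = ϖE) (h2 : Valued.v (2 : K) < 1)
    {α : K} (hΘα : Θ α = α) (hα1 : Valued.v α ≤ 1) (hαρ : Valued.v (α - ρ α) = 1)
    {d : ℕ} (hd2 : 2 ≤ d)
    (hNeq : ∀ e : K, ρ e = e → ∀ r : ℕ, d ≤ r → Valued.v e = Valued.v ϖE ^ r → r % 2 ≠ d % 2 →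
      Valued.v (e + Θ e + e * Θ e) = Valued.v ϖE ^ (r + d - 1))
    {ξ : K} (hξ : ξ * Θ ξ = 1) {m jl : ℕ} (hdm : d ≤ m)
    (hm : Valued.v (ξ - 1) = exp (-(m : ℤ))) (hjl : Valued.v (ξ - ρ ξ) = exp (-(jl : ℤ))) :
    m % 2 = d % 2 ∧ m ≤ jl ∧ jl % 2 = d % 2 := by
  have hπ : ∀ n : ℕ, Valued.v ϖE ^ n = exp (-(n : ℤ)) := Literature.NumberTheory.LocalFields.WildQuadraticDatum.v_varpi_pow hϖE
  have hαne : ρ α ≠ α := fun h => by rw [h, sub_self, map_zero] at hαρ; exact zero_ne_one hαρ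
  -- ## coordinates of `ξ − 1` over `E` in the basis `1, α`
  obtain ⟨e₀, e₁, he₀, he₁, hηco⟩ := Literature.NumberTheory.LocalFields.exists_fixed_coords_of_map_ne hρρ hαne (ξ - 1)
  have hΘe₀ : ρ (Θ e₀) = Θ e₀ := by rw [hρΘ, he₀]
  have hΘe₁ : ρ (Θ e₁) = Θ e₁ := by rw [hρΘ, he₁]
  have hηρ : ξ - ρ ξ = e₁ * (α - ρ α) := by
    have h : (ξ - 1) - ρ (ξ - 1) = ξ - ρ ξ := by rw [map_sub ρ, map_one ρ]; ring
    rw [← h, hηco, map_add, map_mul, he₀, he₁]; ring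
  have hve₁ : Valued.v e₁ = exp (-(jl : ℤ)) := by
    have h : Valued.v (ξ - ρ ξ) = Valued.v e₁ := by rw [hηρ, Valuation.map_mul, hαρ, mul_one]
    rw [← h, hjl]
  have hmax : max (Valued.v e₀) (Valued.v e₁) = exp (-(m : ℤ)) := by
    rw [← v_coords_eq_max hρv hα1 hαρ he₀ he₁, ← hηco, hm]
  have hmjl : m ≤ jl := by
    have h : Valued.v e₁ ≤ exp (-(m : ℤ)) := hmax ▸ le_max_right _ _
    rw [hve₁, exp_le_exp] at h; omega
  -- ## the trace `T` and norm `N` of `α` over `F`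
  set T := α + ρ α with hT
  set N := α * ρ α with hN
  have hρT : ρ T = T := by rw [hT, map_add, hρρ, add_comm]
  have hρN : ρ N = N := by rw [hN, map_mul, hρρ, mul_comm]
  have hα2 : α * α = T * α - N := by rw [hT, hN]; ring
  have hvT : Valued.v T = 1 := by
    have h : T = (α - ρ α) + 2 * ρ α := by rw [hT]; ring
    rw [h]
    refine (Valuation.map_add_eq_of_lt_left _ ?_).trans hαρ
    rw [hαρ, Valuation.map_mul, hρv]
    calc Valued.v (2 : K) * Valued.v α ≤ Valued.v (2 : K) * 1 := by gcongr
      _ < 1 := by rw [mul_one]; exact h2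
  have hN1 : Valued.v N ≤ 1 := by rw [hN, Valuation.map_mul, hρv]; exact mul_le_one' hα1 hα1
  -- ## comparing coordinates in `ξ·Θξ = 1`
  have hξco : ξ = 1 + e₀ + e₁ * α := by linear_combination hηco
  have hΘξ : Θ ξ = 1 + Θ e₀ + Θ e₁ * α := by
    rw [hξco, map_add, map_add, map_one, map_mul, hΘα]
  have hkey : ((1 + e₀) * (1 + Θ e₀) - N * (e₁ * Θ e₁) - 1) + ((1 + e₀) * Θ e₁ + e₁ * (1 + Θ e₀) + T * (e₁ * Θ e₁)) * α = 0 := by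
    have h : (1 + e₀ + e₁ * α) * (1 + Θ e₀ + Θ e₁ * α) = 1 := by rw [← hΘξ, ← hξco]; exact hξ
    linear_combination h - (e₁ * Θ e₁) * hα2
  have hA : ρ ((1 + e₀) * (1 + Θ e₀) - N * (e₁ * Θ e₁) - 1) = (1 + e₀) * (1 + Θ e₀) - N * (e₁ * Θ e₁) - 1 := by
    simp only [map_sub, map_add, map_mul, map_one, he₀, he₁, hΘe₀, hΘe₁, hρN]
  have hB : ρ ((1 + e₀) * Θ e₁ + e₁ * (1 + Θ e₀) + T * (e₁ * Θ e₁)) = (1 + e₀) * Θ e₁ + e₁ * (1 + Θ e₀) + T * (e₁ * Θ e₁) := by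
    simp only [map_add, map_mul, map_one, he₀, he₁, hΘe₀, hΘe₁, hρT]
  obtain ⟨hP₁, hP₀⟩ := coords_eq_zero hαne hA hB hkey
  -- ## units: `|e₀| < 1`, `ε₀ = 1 + e₀` and `Θε₀` are units
  have hm1 : 1 ≤ m := le_trans (by omega) hdm
  have hve₀lt : Valued.v e₀ < 1 := by
    refine lt_of_le_of_lt (hmax ▸ le_max_left _ _ : Valued.v e₀ ≤ exp (-(m : ℤ))) ?_
    rw [← exp_zero, exp_lt_exp]; omega
  have hε0 : (1 + e₀) ≠ 0 := fun h => by
    have h' : e₀ = -1 := by linear_combination h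
    rw [h', Valuation.map_neg, Valuation.map_one] at hve₀lt
    exact lt_irrefl _ hve₀lt
  have hΘε0 : (1 + Θ e₀) ≠ 0 := fun h => by
    have h' := congrArg Θ h
    rw [map_add, map_one, hΘΘ, map_zero] at h'
    exact hε0 h'
  have hvε : Valued.v (1 + e₀) = 1 := by
    rw [Valuation.map_add_eq_of_lt_left _ (by rw [Valuation.map_one]; exact hve₀lt), Valuation.map_one]
  -- ## `q := e₁ ∕ (1 + e₀)`: `ρ`-fixed, `|q| = exp(−jl)`, and the TRACE identity `q + Θq + T·qΘq = 0`
  set q := e₁ / (1 + e₀) with hqdef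
  have hρq : ρ q = q := by rw [hqdef, map_div₀, he₁, map_add, map_one, he₀]
  have hΘq : Θ q = Θ e₁ / (1 + Θ e₀) := by rw [hqdef, map_div₀, map_add, map_one]
  have hvq : Valued.v q = exp (-(jl : ℤ)) := by rw [hqdef, map_div₀, hvε, div_one, hve₁]
  have hvΘq : Valued.v (Θ q) = exp (-(jl : ℤ)) := by rw [hΘv, hvq]
  have hqε : q * (1 + e₀) = e₁ := by rw [hqdef, div_mul_cancel₀ _ hε0]
  have hΘqε : Θ q * (1 + Θ e₀) = Θ e₁ := by rw [hΘq, div_mul_cancel₀ _ hΘε0]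
  have htr : q + Θ q + T * (q * Θ q) = 0 := by
    have h : (q + Θ q + T * (q * Θ q)) * ((1 + e₀) * (1 + Θ e₀)) = 0 := by
      have h' := hP₁
      rw [← hΘqε, ← hqε] at h'
      linear_combination h'
    exact (mul_eq_zero.1 h).resolve_right (mul_ne_zero hε0 hΘε0)
  -- ## the `F`-element `π₂ := ϖE·ΘϖE` of valuation `exp(−2)`
  set π₂ := ϖE * Θ ϖE with hπ₂
  have hρπ₂ : ρ π₂ = π₂ := by rw [hπ₂, map_mul, hρϖ, hρΘ, hρϖ]
  have hΘπ₂ : Θ π₂ = π₂ := by rw [hπ₂, map_mul, hΘΘ, mul_comm]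
  have hvπ₂ : Valued.v π₂ = exp (-2 : ℤ) := by
    rw [hπ₂, Valuation.map_mul, hΘv, hϖE, ← exp_add]; rfl
  -- ## `jl ≡ d (mod 2)`: the norm-depth law on `e := q·π₂`
  have hjlpar : jl % 2 = d % 2 := by
    by_contra hne
    set e := q * π₂ with he
    have hρe : ρ e = e := by rw [he, map_mul, hρq, hρπ₂]
    have hΘe : Θ e = Θ q * π₂ := by rw [he, map_mul, hΘπ₂]
    have hve : Valued.v e = Valued.v ϖE ^ (jl + 2) := by
      rw [hπ, he, Valuation.map_mul, hvq, hvπ₂, ← exp_add]; congr 1; push_cast; ring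
    have hNe : e + Θ e + e * Θ e = π₂ * (q * Θ q) * (π₂ - T) := by
      rw [hΘe, he]; linear_combination π₂ * htr
    have hsub : Valued.v (π₂ - T) = 1 := by
      rw [show π₂ - T = -T + π₂ by ring, Valuation.map_add_eq_of_lt_left _ (by
        rw [Valuation.map_neg, hvT, hvπ₂, ← exp_zero, exp_lt_exp]; norm_num), Valuation.map_neg, hvT]
    have hvNe : Valued.v (e + Θ e + e * Θ e) = exp (-(2 * (jl : ℤ) + 2)) := by
      rw [hNe, Valuation.map_mul _ _ (π₂ - T), Valuation.map_mul _ π₂, Valuation.map_mul _ q (Θ q), hvπ₂, hvq, hvΘq, hsub, mul_one,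
        ← exp_add, ← exp_add]
      congr 1; ring
    have heq := hNeq e hρe (jl + 2) (by omega) hve (by omega)
    rw [hvNe, hπ, exp_inj] at heq
    omega
  -- ## `m ≡ d (mod 2)`: the norm-depth law on `e₀` (`N_{E∕F}(1 + e₀) − 1` has valuation `≤ exp(−2jl)`)
  have hmpar : m % 2 = d % 2 := by
    by_contra hne
    have hmlt : m < jl := by omega
    have hve₀ : Valued.v e₀ = exp (-(m : ℤ)) := by
      have hlt : Valued.v e₁ < exp (-(m : ℤ)) := by rw [hve₁, exp_lt_exp]; omega
      rcases le_total (Valued.v e₁) (Valued.v e₀) with h | h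
      · rwa [max_eq_left h] at hmax
      · rw [max_eq_right h] at hmax; exact absurd hmax hlt.ne
    have hW : (e₀ + Θ e₀ + e₀ * Θ e₀) * (1 - N * (q * Θ q)) = N * (q * Θ q) := by
      have h := hP₀
      rw [← hΘqε, ← hqε] at h
      linear_combination h
    have hvNq : Valued.v (N * (q * Θ q)) ≤ exp (-(2 * (jl : ℤ))) := by
      rw [Valuation.map_mul _ N, Valuation.map_mul _ q (Θ q), hvq, hvΘq, ← exp_add]
      calc Valued.v N * exp (-(jl : ℤ) + -(jl : ℤ)) ≤ 1 * exp (-(jl : ℤ) + -(jl : ℤ)) := by gcongr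
        _ = exp (-(2 * (jl : ℤ))) := by rw [one_mul]; congr 1; ring
    have hvden : Valued.v (1 - N * (q * Θ q)) = 1 := by
      rw [sub_eq_add_neg, Valuation.map_add_eq_of_lt_left _ ?_, Valuation.map_one]
      rw [Valuation.map_neg, Valuation.map_one]
      exact lt_of_le_of_lt hvNq (by rw [← exp_zero, exp_lt_exp]; omega)
    have hvW : Valued.v (e₀ + Θ e₀ + e₀ * Θ e₀) ≤ exp (-(2 * (jl : ℤ))) := by
      have h := congrArg Valued.v hW
      rw [Valuation.map_mul, hvden, mul_one] at h
      rw [h]; exact hvNq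
    have heq := hNeq e₀ he₀ m hdm (by rw [hπ, hve₀]) hne
    rw [heq, hπ, exp_le_exp] at hvW
    omega
  exact ⟨hmpar, hmjl, hjlpar⟩

/-! ## §2 The sheet's letters: `ξ = lam ∕ u` -/

/-- **REALIZABILITY IN THE SHEET'S LETTERS, TYPE RamK** (`hpar ∧ hm ∧ hjl` of ★ `toricCensusSum_ramK` as facts): for `lam` Θ-unitary (`lam·Θ lam = 1`), `u ∈ E¹` (`ρu = u`,
`u·Θu = 1`), `μ := lam − u` with `|μ| = exp(−m)`, `|μ − ρμ| = exp(−jl)`, `d ≤ m`, under the abstract type-RamK hypotheses of `realizable_of_thetaUnitary_ramK`: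
`m ≡ d (2) ∧ m ≤ jl ∧ jl ≡ d (2)` (apply it to `ξ := lam∕u`: `μ = u(ξ − 1)`, `μ − ρμ = u(ξ − ρξ)`, `|u| = 1`).
[cite: Serre1979, Ch. V §3 Prop. 5] [cite: Rogawski1990, §4.9 Lemma 4.9.3 p. 56] [cite: Kottwitz1986BaseChangeUnits, §1 pp. 240–241] -/
theorem realizable_of_frame_ramK {ρ Θ : K →+* K} (hρρ : ∀ x, ρ (ρ x) = x) (hΘΘ : ∀ x, Θ (Θ x) = x) (hρΘ : ∀ x, ρ (Θ x) = Θ (ρ x))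
    (hρv : ∀ x, Valued.v (ρ x) = Valued.v x) (hΘv : ∀ x, Valued.v (Θ x) = Valued.v x)
    {ϖE : K} (hϖE : Valued.v ϖE = exp (-1 : ℤ)) (hρϖ : ρ ϖE = ϖE) (h2 : Valued.v (2 : K) < 1)
    {α : K} (hΘα : Θ α = α) (hα1 : Valued.v α ≤ 1) (hαρ : Valued.v (α - ρ α) = 1)
    {d : ℕ} (hd2 : 2 ≤ d)
    (hNeq : ∀ e : K, ρ e = e → ∀ r : ℕ, d ≤ r → Valued.v e = Valued.v ϖE ^ r → r % 2 ≠ d % 2 →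
      Valued.v (e + Θ e + e * Θ e) = Valued.v ϖE ^ (r + d - 1))
    {lam u : K} (hlam : lam * Θ lam = 1) (hu : ρ u = u) (hu1 : u * Θ u = 1)
    {m jl : ℕ} (hdm : d ≤ m) (hm : Valued.v (lam - u) = exp (-(m : ℤ))) (hjl : Valued.v ((lam - u) - ρ (lam - u)) = exp (-(jl : ℤ))) :
    m % 2 = d % 2 ∧ m ≤ jl ∧ jl % 2 = d % 2 := by
  have hu0 : u ≠ 0 := fun h => by rw [h, zero_mul] at hu1; exact zero_ne_one hu1
  have hvu : Valued.v u = 1 := by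
    have h : Valued.v u * Valued.v u = 1 := by
      have h' := congrArg Valued.v hu1
      rwa [Valuation.map_mul, hΘv, Valuation.map_one] at h'
    rcases lt_trichotomy (Valued.v u) 1 with h1 | h1 | h1
    · exfalso
      have hlt : Valued.v u * Valued.v u < 1 :=
        calc Valued.v u * Valued.v u ≤ Valued.v u * 1 := by gcongr
          _ < 1 := by rw [mul_one]; exact h1
      rw [h] at hlt; exact lt_irrefl _ hlt
    · exact h1
    · exfalso
      have hlt : 1 < Valued.v u * Valued.v u :=
        calc (1 : ℤᵐ⁰) < Valued.v u := h1
          _ = Valued.v u * 1 := (mul_one _).symm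
          _ ≤ Valued.v u * Valued.v u := by gcongr
      rw [h] at hlt; exact lt_irrefl _ hlt
  have hξ : (lam / u) * Θ (lam / u) = 1 := by
    rw [map_div₀, div_mul_div_comm, hlam, hu1, div_one]
  have hm' : Valued.v (lam / u - 1) = exp (-(m : ℤ)) := by
    have h : lam / u - 1 = (lam - u) / u := by field_simp
    rw [h, map_div₀, hvu, div_one, hm]
  have hjl' : Valued.v (lam / u - ρ (lam / u)) = exp (-(jl : ℤ)) := by
    have h : lam / u - ρ (lam / u) = ((lam - u) - ρ (lam - u)) / u := by
      rw [map_div₀, hu, map_sub, hu]; field_simp; ring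
    rw [h, map_div₀, hvu, div_one, hjl]
  exact realizable_of_thetaUnitary_ramK hρρ hΘΘ hρΘ hρv hΘv hϖE hρϖ h2 hΘα hα1 hαρ hd2 hNeq hξ hdm hm' hjl'

/-! ## §3 THE `ε = −1` WINDOW: for `ℓ ≥ 2d − 1`, «some side alive» ⇒ «hyperbolic side alive» (T5b (D3) `halive` letters) -/

/-- **THE (D3) UNIT OF THE HYPERBOLIC SIDE HAS ρ-DEPTH EXACTLY `ℓ`** (bridge to the T5b (D3) letters): for `μ` with `|μ| = exp(−m)`, `|μ − ρμ| = exp(−(ℓ + m))`, a hyperbolic side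
scalar `h` (`ρh = −h`), the frame generator `α₀`, a `ρ`-fixed `ϖE` and the unit `z₊ := μ·h·(α₀ − ρα₀)∕ϖE^n` (`|z₊| = 1`): `|z₊ − ρz₊| = exp(−ℓ)` — `h·(α₀ − ρα₀)` and `ϖE` are
`ρ`-fixed, so `z₊ − ρz₊ = (μ − ρμ)·h(α₀ − ρα₀)∕ϖE^n`. [cite: Jacobowitz1962, §4] [cite: Flicker1998UnitaryFL, p. 84] -/
theorem v_diagUnit_sub_map {ρ : K →+* K} (hρρ : ∀ x, ρ (ρ x) = x)
    {μ h α₀ ϖE : K} (hρh : ρ h = -h) (hρϖ : ρ ϖE = ϖE) {n : ℤ} {m ℓ : ℕ}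
    (hμ : Valued.v μ = exp (-(m : ℤ))) (hμρ : Valued.v (μ - ρ μ) = exp (-((ℓ : ℤ) + m)))
    (hz : Valued.v (μ * h * (α₀ - ρ α₀) / ϖE ^ n) = 1) :
    Valued.v (μ * h * (α₀ - ρ α₀) / ϖE ^ n - ρ (μ * h * (α₀ - ρ α₀) / ϖE ^ n)) = exp (-(ℓ : ℤ)) := by
  have hρz : ρ (μ * h * (α₀ - ρ α₀) / ϖE ^ n) = ρ μ * h * (α₀ - ρ α₀) / ϖE ^ n := by
    rw [map_div₀, map_mul, map_mul, map_sub, hρh, hρρ, map_zpow₀, hρϖ]; ring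
  have hfac : μ * h * (α₀ - ρ α₀) / ϖE ^ n = μ * (h * (α₀ - ρ α₀) / ϖE ^ n) := by ring
  have hrest : Valued.v (h * (α₀ - ρ α₀) / ϖE ^ n) = exp (m : ℤ) := by
    rw [hfac, Valuation.map_mul, hμ] at hz
    rw [eq_inv_of_mul_eq_one_right hz, ← exp_neg, neg_neg]
  have hdiff : μ * h * (α₀ - ρ α₀) / ϖE ^ n - ρ (μ * h * (α₀ - ρ α₀) / ϖE ^ n) = (μ - ρ μ) * (h * (α₀ - ρ α₀) / ϖE ^ n) := by
    rw [hρz]; ring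
  rw [hdiff, Valuation.map_mul, hμρ, hrest, ← exp_add]
  congr 1; ring

/-- **THE `ε = −1` WINDOW OF TYPE RamK** (`ε = −1 ⇒ jl ≤ m + 2d − 2`, i.e. for `ℓ = jl − m ≥ 2d − 1` the hyperbolic side wins).  Frame: `ρ, Θ` commuting (`ρ` involutive, both
isometric), `ϖE` a uniformiser, `α` integral `Θ`-fixed with `|α − ρα| = 1` (third field `K♮ = Fix Θ` unramified over `F`), `Θ`-fixed elements of even valuation (`hΘev`), the two
RamK norm suppliers `hNF` (`𝒪_Fˣ ⊆ N_{M∕K♮}(𝒪_Mˣ)`, ★ `QuadraticDatumNormsOfDoublyFixedUnits`) and `hNd` (`U_{K♮}^{(d)} ⊆ N`, ★ `WildQuadraticDatumNormSurjective`), `1 ≤ d`.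
Let `z` be a unit with `|z − ρz| ≤ exp(−ℓ)`, `2d ≤ ℓ + 1`, and `c ≥ 1`.  If `z = k·e·w` with `k` a `Θ`-fixed unit, `e` a `ρ`-fixed unit, `|w − 1| ≤ exp(−c)` (the cell is alive on SOME
side: `z ∈ 𝒪_{K♮}ˣ·𝒪_Eˣ·U^{(c)}`), then `z = x·Θx·e′·w′` with `|x| = 1`, `e′` a `ρ`-fixed unit, `|w′ − 1| ≤ exp(−c)` — the (D3) `halive` datum of ★ T5b `ncard_levelSetDep_diag_of_mem`
for the HYPERBOLIC side.  Mechanism: `k = f₀(1 + gα)`, `f₀ ∈ 𝒪_Fˣ` a norm, `g ∈ F` with `|g| ≤ max(exp(−ℓ), exp(−c))`; either `1 + gα ∈ U^{(c)}` or `|g| ≤ exp(−2d)` (even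
valuation) and `1 + gα` is a norm. [cite: Serre1979, Ch. V §2 Prop. 3, §3 Cor. 3] [cite: Flicker1998UnitaryFL, p. 84] [cite: Jacobowitz1962, §4] -/
theorem hyperbolic_alive_of_alive_of_two_mul_le {ρ Θ : K →+* K} (hρρ : ∀ x, ρ (ρ x) = x) (hρΘ : ∀ x, ρ (Θ x) = Θ (ρ x))
    (hρv : ∀ x, Valued.v (ρ x) = Valued.v x) (hΘv : ∀ x, Valued.v (Θ x) = Valued.v x)
    {ϖE : K} (hϖE : Valued.v ϖE = exp (-1 : ℤ))
    {α : K} (hΘα : Θ α = α) (hα1 : Valued.v α ≤ 1) (hαρ : Valued.v (α - ρ α) = 1)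
    (hΘev : ∀ x : K, Θ x = x → x ≠ 0 → ∃ n : ℤ, Valued.v x = exp (2 * n))
    {d : ℕ} (hd : 1 ≤ d)
    (hNF : ∀ f : K, ρ f = f → Θ f = f → Valued.v f = 1 → ∃ x : K, x * Θ x = f)
    (hNd : ∀ u : K, Θ u = u → Valued.v (u - 1) ≤ Valued.v ϖE ^ (2 * d) → ∃ x : K, x * Θ x = u)
    {z : K} (hz1 : Valued.v z = 1) {ℓ : ℕ} (hdℓ : 2 * d ≤ ℓ + 1) (hzρ : Valued.v (z - ρ z) ≤ exp (-(ℓ : ℤ)))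
    {c : ℕ} (hc : 1 ≤ c)
    (halive : ∃ k e w : K, Θ k = k ∧ Valued.v k = 1 ∧ ρ e = e ∧ Valued.v e = 1 ∧ Valued.v (w - 1) ≤ exp (-(c : ℤ)) ∧ z = k * e * w) :
    ∃ x e w : K, Valued.v x = 1 ∧ ρ e = e ∧ Valued.v e = 1 ∧ Valued.v (w - 1) ≤ exp (-(c : ℤ)) ∧ z = x * Θ x * e * w := by
  have hπ : ∀ n : ℕ, Valued.v ϖE ^ n = exp (-(n : ℤ)) := Literature.NumberTheory.LocalFields.WildQuadraticDatum.v_varpi_pow hϖE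
  have hαne : ρ α ≠ α := fun h => by rw [h, sub_self, map_zero] at hαρ; exact zero_ne_one hαρ
  -- `|x·Θx| = 1 ⇒ |x| = 1`
  have hunit : ∀ x f : K, x * Θ x = f → Valued.v f = 1 → Valued.v x = 1 := by
    intro x f hxf hf
    have h : Valued.v x * Valued.v x = 1 := by rw [← hf, ← hxf, Valuation.map_mul, hΘv]
    rcases lt_trichotomy (Valued.v x) 1 with h1 | h1 | h1
    · exfalso
      have hlt : Valued.v x * Valued.v x < 1 :=
        calc Valued.v x * Valued.v x ≤ Valued.v x * 1 := by gcongr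
          _ < 1 := by rw [mul_one]; exact h1
      rw [h] at hlt; exact lt_irrefl _ hlt
    · exact h1
    · exfalso
      have hlt : 1 < Valued.v x * Valued.v x :=
        calc (1 : ℤᵐ⁰) < Valued.v x := h1
          _ = Valued.v x * 1 := (mul_one _).symm
          _ ≤ Valued.v x * Valued.v x := by gcongr
      rw [h] at hlt; exact lt_irrefl _ hlt
  obtain ⟨k, e, w, hΘk, hvk, hρe, hve, hw, hz⟩ := halive
  -- ## coordinates of `k` over `E`: `k = f₀ + f₁α` with `f₀, f₁ ∈ F`
  obtain ⟨f₀, f₁, hf₀, hf₁, hkco⟩ := Literature.NumberTheory.LocalFields.exists_fixed_coords_of_map_ne hρρ hαne k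
  have hΘf : Θ f₁ = f₁ ∧ Θ f₀ = f₀ := by
    have hA : ρ (Θ f₀ - f₀) = Θ f₀ - f₀ := by rw [map_sub, hρΘ, hf₀]
    have hB : ρ (Θ f₁ - f₁) = Θ f₁ - f₁ := by rw [map_sub, hρΘ, hf₁]
    have hkey : (Θ f₀ - f₀) + (Θ f₁ - f₁) * α = 0 := by
      have h := congrArg Θ hkco
      rw [map_add, map_mul, hΘα, hΘk, hkco] at h
      linear_combination -h
    obtain ⟨h1, h0⟩ := coords_eq_zero hαne hA hB hkey
    exact ⟨sub_eq_zero.1 h1, sub_eq_zero.1 h0⟩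
  -- ## `|f₁| ≤ max(exp(−ℓ), exp(−c)) < 1`, so `f₀` is a unit
  have hvw : Valued.v w = 1 := by
    have h := congrArg Valued.v hz
    rw [hz1, Valuation.map_mul, Valuation.map_mul, hvk, hve, one_mul, one_mul] at h
    exact h.symm
  have hvρw : Valued.v (ρ w) = 1 := by rw [hρv, hvw]
  have hkρ : k - ρ k = f₁ * (α - ρ α) := by rw [hkco, map_add, map_mul, hf₀, hf₁]; ring
  have hid : (k - ρ k) * e * ρ w = (z - ρ z) - k * e * (w - ρ w) := by
    rw [hz, map_mul, map_mul, hρe]; ring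
  have hvf₁ : Valued.v f₁ ≤ max (exp (-(ℓ : ℤ))) (exp (-(c : ℤ))) := by
    have h1 : Valued.v f₁ = Valued.v ((k - ρ k) * e * ρ w) := by
      rw [Valuation.map_mul, Valuation.map_mul, hkρ, Valuation.map_mul, hαρ, hve, hvρw, mul_one, mul_one, mul_one]
    rw [h1, hid]
    refine (Valuation.map_sub _ _ _).trans (max_le_max hzρ ?_)
    rw [Valuation.map_mul, Valuation.map_mul, hvk, hve, one_mul, one_mul]
    have hwρ : w - ρ w = (w - 1) - ρ (w - 1) := by rw [map_sub, map_one]; ring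
    rw [hwρ]
    refine (Valuation.map_sub _ _ _).trans ?_
    rw [hρv, max_self]
    exact hw
  have hvf₁lt : Valued.v f₁ < 1 :=
    lt_of_le_of_lt hvf₁ (max_lt (by rw [← exp_zero, exp_lt_exp]; omega) (by rw [← exp_zero, exp_lt_exp]; omega))
  have hvf₀ : Valued.v f₀ = 1 := by
    have h : max (Valued.v f₀) (Valued.v f₁) = 1 := by rw [← v_coords_eq_max hρv hα1 hαρ hf₀ hf₁, ← hkco, hvk]
    rcases le_total (Valued.v f₁) (Valued.v f₀) with h' | h'
    · rwa [max_eq_left h'] at h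
    · rw [max_eq_right h'] at h; exact absurd h hvf₁lt.ne
  have hf₀0 : f₀ ≠ 0 := fun h => by rw [h, map_zero] at hvf₀; exact zero_ne_one hvf₀
  -- ## `f₀ ∈ 𝒪_Fˣ` is a norm; `k = f₀·(1 + gα)` with `g = f₁∕f₀ ∈ F`
  obtain ⟨x₀, hx₀⟩ := hNF f₀ hf₀ hΘf.2 hvf₀
  have hvx₀ : Valued.v x₀ = 1 := hunit x₀ f₀ hx₀ hvf₀
  set g := f₁ / f₀ with hg
  have hkg : k = f₀ * (1 + g * α) := by rw [hkco, hg]; field_simp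
  have hΘg : Θ g = g := by rw [hg, map_div₀, hΘf.1, hΘf.2]
  have hvg : Valued.v g = Valued.v f₁ := by rw [hg, map_div₀, hvf₀, div_one]
  by_cases hgc : Valued.v f₁ ≤ exp (-(c : ℤ))
  · -- ### `|g| ≤ exp(−c)`: absorb `1 + gα` into `w`
    refine ⟨x₀, e, (1 + g * α) * w, hvx₀, hρe, hve, ?_, ?_⟩
    · have h : (1 + g * α) * w - 1 = (w - 1) + g * (α * w) := by ring
      rw [h]
      refine (Valuation.map_add _ _ _).trans (max_le hw ?_)
      rw [Valuation.map_mul, Valuation.map_mul, hvw, mul_one, hvg]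
      exact (mul_le_of_le_one_right' hα1).trans hgc
    · rw [hz, hkg, hx₀]; ring
  · -- ### `|g| ≤ exp(−ℓ) ≤ exp(−(2d − 1))`, so (even valuation) `|g| ≤ |ϖE|^{2d}` and `1 + gα` is a norm
    have hgℓ : Valued.v f₁ ≤ exp (-(ℓ : ℤ)) := by
      rcases le_max_iff.1 hvf₁ with h | h
      · exact h
      · exact absurd h hgc
    have hg0 : g ≠ 0 := by
      intro h
      rw [h, map_zero] at hvg
      exact hgc (by rw [← hvg]; exact zero_le)
    obtain ⟨n, hn⟩ := hΘev g hΘg hg0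
    have hn' : n ≤ -(d : ℤ) := by
      have h := hgℓ
      rw [← hvg, hn, exp_le_exp] at h
      omega
    have hu1 : Valued.v ((1 + g * α) - 1) ≤ Valued.v ϖE ^ (2 * d) := by
      rw [hπ, add_sub_cancel_left, Valuation.map_mul, hn]
      calc exp (2 * n) * Valued.v α ≤ exp (2 * n) * 1 := by gcongr
        _ ≤ exp (-((2 * d : ℕ) : ℤ)) := by rw [mul_one, exp_le_exp]; push_cast; omega
    have hΘu : Θ (1 + g * α) = 1 + g * α := by rw [map_add, map_one, map_mul, hΘg, hΘα]
    obtain ⟨x₁, hx₁⟩ := hNd (1 + g * α) hΘu hu1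
    have hvu : Valued.v (1 + g * α) = 1 := by
      have h : Valued.v k = Valued.v f₀ * Valued.v (1 + g * α) := by rw [hkg, Valuation.map_mul]
      rw [hvk, hvf₀, one_mul] at h
      exact h.symm
    have hvx₁ : Valued.v x₁ = 1 := hunit x₁ (1 + g * α) hx₁ hvu
    refine ⟨x₀ * x₁, e, w, ?_, hρe, hve, hw, ?_⟩
    · rw [Valuation.map_mul, hvx₀, hvx₁, mul_one]
    · rw [hz, hkg, ← hx₀, ← hx₁, map_mul]; ring

end Summit.HodgeConjecture.HodgeConjecture.Cruxes.H413.F0P3cDyRamTokenRealizabilityRamK
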